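import Mathlib
import Literature.AlgebraicGeometry.Resolution.FormalCoordinateChange

/-!
# The formal inverse function theorem for `k[[x₁,…,xₙ]]` (compositional inverses of `subst`)

Folklore, missing from Mathlib in several variables (Mathlib has the one-variable
`PowerSeries.substInv`).  For a substitution family `θ : Fin n → MvPowerSeries (Fin n) k` with
zero constant terms and invertible linear part (`IsUnit (linMat θ).det`, the matrix of the crux
`LocalWeightedDrop`, stmt-ResolutionOfSingularities-8899) there is `ψ` with zero constant terms
such that

  `MvPowerSeries.subst ψ (θ s) = X s`  and  `MvPowerSeries.subst θ (ψ s) = X s`  for all `s`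

(`exists_comp_inverse`): the formal coordinate change is an automorphism, and ARCS / singular
loci can be transported between the two coordinate systems (the use in the local weighted
resolution game: lifting the singular arcs of a germ through the prover's coordinate change).

Proof.  `AgreeUpTo r u v` (same coefficients in degrees `≤ r`) is a congruence for `+`, `*`,
`subst`, and GAINS one degree under products of two factors in `𝔪` (`AgreeUpTo.mul_gain`) hence
under substitution into a series of order `≥ 2` (`AgreeUpTo.subst_gain`).  For `N = X + h`
tangent to the identity (`TangentId`, `ord h ≥ 2`) the Newton iteration `M₀ = X`,
`M_{j+1} = X - h(M_j)` (`iter`) is stable in degrees `≤ j` (`iter_stable`); its coefficientwise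
limit `invT N` satisfies `N(invT N) = X` (`subst_invT`) and is again tangent to the identity, and
the right inverse of the right inverse is `N` itself, so `invT N` is two-sided
(`subst_invT_left`).  A general `θ` is `L · normalize θ` (part I, `theta_eq_linSubst_normalize`)
and `ψ := (invT (normalize θ)) ∘ L⁻¹` works (`exists_comp_inverse`).
-/

open MvPowerSeries

namespace Literature.AlgebraicGeometry.Resolution.FormalCoordChange

variable {k : Type*} [Field k] {n : ℕ}


/-! ### Agreement up to a degree -/

/-- `u` and `v` have the same coefficients in all degrees `≤ r`. [folklore] -/
def AgreeUpTo (r : ℕ) (u v : MvPowerSeries (Fin n) k) : Prop :=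
  ∀ e : Fin n →₀ ℕ, e.degree ≤ r → MvPowerSeries.coeff e u = MvPowerSeries.coeff e v

/-- `agreeUpTo_iff_order` (see the module docstring). [folklore] -/
theorem agreeUpTo_iff_order {r : ℕ} {u v : MvPowerSeries (Fin n) k} :
    AgreeUpTo r u v ↔ ((r + 1 : ℕ) : ℕ∞) ≤ (u - v).order := by
  constructor
  · intro h
    apply MvPowerSeries.nat_le_order
    intro e he
    rw [map_sub, h e (by exact_mod_cast Nat.lt_succ_iff.mp he), sub_self]
  · intro h e he
    have := MvPowerSeries.coeff_of_lt_order (f := u - v) (d := e)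
      (lt_of_lt_of_le (by exact_mod_cast Nat.lt_succ_of_le he) h)
    rwa [map_sub, sub_eq_zero] at this

/-- `AgreeUpTo.refl` (see the module docstring). [folklore] -/
theorem AgreeUpTo.refl (r : ℕ) (u : MvPowerSeries (Fin n) k) : AgreeUpTo r u u := fun _ _ => rfl

/-- `AgreeUpTo.symm` (see the module docstring). [folklore] -/
theorem AgreeUpTo.symm {r : ℕ} {u v : MvPowerSeries (Fin n) k} (h : AgreeUpTo r u v) : AgreeUpTo r v u :=
  fun e he => (h e he).symm

/-- `AgreeUpTo.trans` (see the module docstring). [folklore] -/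
theorem AgreeUpTo.trans {r : ℕ} {u v w : MvPowerSeries (Fin n) k} (h : AgreeUpTo r u v)
    (h' : AgreeUpTo r v w) : AgreeUpTo r u w := fun e he => (h e he).trans (h' e he)

/-- `AgreeUpTo.mono` (see the module docstring). [folklore] -/
theorem AgreeUpTo.mono {r r' : ℕ} (hr : r' ≤ r) {u v : MvPowerSeries (Fin n) k} (h : AgreeUpTo r u v) :
    AgreeUpTo r' u v := fun e he => h e (he.trans hr)

/-- `AgreeUpTo.add` (see the module docstring). [folklore] -/
theorem AgreeUpTo.add {r : ℕ} {u v u' v' : MvPowerSeries (Fin n) k} (h : AgreeUpTo r u u')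
    (h' : AgreeUpTo r v v') : AgreeUpTo r (u + v) (u' + v') := by
  intro e he; simp [map_add, h e he, h' e he]

/-- `AgreeUpTo.sub` (see the module docstring). [folklore] -/
theorem AgreeUpTo.sub {r : ℕ} {u v u' v' : MvPowerSeries (Fin n) k} (h : AgreeUpTo r u u')
    (h' : AgreeUpTo r v v') : AgreeUpTo r (u - v) (u' - v') := by
  intro e he; simp [map_sub, h e he, h' e he]

/-- `AgreeUpTo.mul` (see the module docstring). [folklore] -/
theorem AgreeUpTo.mul {r : ℕ} {u v u' v' : MvPowerSeries (Fin n) k} (h : AgreeUpTo r u u')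
    (h' : AgreeUpTo r v v') : AgreeUpTo r (u * v) (u' * v') := by
  rw [agreeUpTo_iff_order] at h h' ⊢
  have e1 : u * v - u' * v' = u * (v - v') + (u - u') * v' := by ring
  rw [e1]
  refine le_trans ?_ MvPowerSeries.min_order_le_add
  refine le_min ?_ ?_
  · exact le_trans (by simpa using h') (le_trans (le_add_self) MvPowerSeries.le_order_mul)
  · exact le_trans (by simpa using h) (le_trans (le_self_add) MvPowerSeries.le_order_mul)

/-- ORDER GAIN: products of two series with zero constant terms that agree up to degree `r`
agree up to degree `r + 1`. [folklore] -/
theorem AgreeUpTo.mul_gain {r : ℕ} {u v u' v' : MvPowerSeries (Fin n) k} (h : AgreeUpTo r u u')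
    (h' : AgreeUpTo r v v') (hu : MvPowerSeries.constantCoeff u = 0)
    (hv' : MvPowerSeries.constantCoeff v' = 0) : AgreeUpTo (r + 1) (u * v) (u' * v') := by
  rw [agreeUpTo_iff_order] at h h' ⊢
  have e1 : u * v - u' * v' = u * (v - v') + (u - u') * v' := by ring
  rw [e1]
  have hu1 : (1 : ℕ∞) ≤ u.order := MvPowerSeries.one_le_order_iff_constCoeff_eq_zero.mpr hu
  have hv1 : (1 : ℕ∞) ≤ v'.order := MvPowerSeries.one_le_order_iff_constCoeff_eq_zero.mpr hv'
  refine le_trans ?_ MvPowerSeries.min_order_le_add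
  refine le_min ?_ ?_
  · refine le_trans ?_ MvPowerSeries.le_order_mul
    calc (((r + 1 + 1 : ℕ)) : ℕ∞) = 1 + ((r + 1 : ℕ) : ℕ∞) := by push_cast; ring
      _ ≤ u.order + (v - v').order := add_le_add hu1 h'
  · refine le_trans ?_ MvPowerSeries.le_order_mul
    calc (((r + 1 + 1 : ℕ)) : ℕ∞) = ((r + 1 : ℕ) : ℕ∞) + 1 := by push_cast; ring
      _ ≤ (u - u').order + v'.order := add_le_add h hv1

/-- `AgreeUpTo.prod` (see the module docstring). [folklore] -/
theorem AgreeUpTo.prod {r : ℕ} {ι : Type*} (s : Finset ι) {u u' : ι → MvPowerSeries (Fin n) k}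
    (h : ∀ i ∈ s, AgreeUpTo r (u i) (u' i)) : AgreeUpTo r (∏ i ∈ s, u i) (∏ i ∈ s, u' i) := by
  classical
  induction s using Finset.induction_on with
  | empty => simp [AgreeUpTo.refl]
  | insert a s ha ih =>
    rw [Finset.prod_insert ha, Finset.prod_insert ha]
    exact (h a (Finset.mem_insert_self a s)).mul (ih fun i hi => h i (Finset.mem_insert_of_mem hi))

/-- `AgreeUpTo.pow` (see the module docstring). [folklore] -/
theorem AgreeUpTo.pow {r : ℕ} {u u' : MvPowerSeries (Fin n) k} (h : AgreeUpTo r u u') (m : ℕ) :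
    AgreeUpTo r (u ^ m) (u' ^ m) := by
  induction m with
  | zero => simp [AgreeUpTo.refl]
  | succ m ih => rw [pow_succ, pow_succ]; exact ih.mul h

/-- ORDER GAIN for monomials of degree `≥ 2` in families with zero constant terms. [folklore] -/
theorem AgreeUpTo.finsuppProd_gain {r : ℕ} {a a' : Fin n → MvPowerSeries (Fin n) k}
    (h : ∀ i, AgreeUpTo r (a i) (a' i)) (ha : ∀ i, MvPowerSeries.constantCoeff (a i) = 0)
    (ha' : ∀ i, MvPowerSeries.constantCoeff (a' i) = 0) (d : Fin n →₀ ℕ) (hd : 2 ≤ d.degree) :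
    AgreeUpTo (r + 1) (d.prod fun i m => a i ^ m) (d.prod fun i m => a' i ^ m) := by
  classical
  -- split off one factor `a i₀` from a variable with `d i₀ ≥ 1`; the rest has ≥ 1 factor left
  have hd0 : d ≠ 0 := by intro h0; rw [h0] at hd; simp at hd
  obtain ⟨i₀, hi₀⟩ : ∃ i, d i ≠ 0 := by
    by_contra hcon; push Not at hcon; exact hd0 (Finsupp.ext hcon)
  -- d = single i₀ 1 + d'
  set d' := d - Finsupp.single i₀ 1 with hd'
  have hsplit : d = Finsupp.single i₀ 1 + d' := by
    ext j
    by_cases hj : j = i₀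
    · subst hj; simp [hd']; omega
    · simp [hd', Ne.symm hj]
  have hdeg' : 1 ≤ d'.degree := by
    have := congrArg Finsupp.degree hsplit
    rw [map_add, Finsupp.degree_single] at this
    omega
  have key : ∀ (b : Fin n → MvPowerSeries (Fin n) k), (∀ i, MvPowerSeries.constantCoeff (b i) = 0) →
      (d.prod fun i m => b i ^ m) = b i₀ * d'.prod fun i m => b i ^ m := by
    intro b hb
    rw [hsplit, Finsupp.prod_add_index' (h := fun i m => b i ^ m) (fun _ => pow_zero _)
      (fun _ _ _ => pow_add _ _ _), Finsupp.prod_single_index (h := fun i m => b i ^ m) (pow_zero _),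
      pow_one]
  rw [key a ha, key a' ha']
  -- the remaining product has zero constant coefficient (degree d' ≥ 1)
  have hrest : ∀ (b : Fin n → MvPowerSeries (Fin n) k), (∀ i, MvPowerSeries.constantCoeff (b i) = 0) →
      MvPowerSeries.constantCoeff (d'.prod fun i m => b i ^ m) = 0 := by
    intro b hb
    obtain ⟨j₀, hj₀⟩ : ∃ j, d' j ≠ 0 := by
      by_contra hcon; push Not at hcon
      have : d' = 0 := Finsupp.ext hcon
      rw [this] at hdeg'; simp at hdeg'
    rw [Finsupp.prod, map_prod]
    apply Finset.prod_eq_zero (Finsupp.mem_support_iff.mpr hj₀)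
    rw [map_pow, hb j₀, zero_pow hj₀]
  refine AgreeUpTo.mul_gain (h i₀) ?_ (ha i₀) (hrest a' ha')
  rw [Finsupp.prod, Finsupp.prod]
  exact AgreeUpTo.prod _ fun i _ => (h i).pow _


/-! ### Substitution respects agreement; order gain for `H ∈ 𝔪²` -/

/-- `AgreeUpTo.coeff_eq` (see the module docstring). [folklore] -/
theorem AgreeUpTo.coeff_eq {r : ℕ} {u v : MvPowerSeries (Fin n) k} (h : AgreeUpTo r u v)
    {e : Fin n →₀ ℕ} (he : e.degree ≤ r) : MvPowerSeries.coeff e u = MvPowerSeries.coeff e v := h e he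

/-- Substituting agreeing families (zero constant terms) into ANY series gives agreeing results. [folklore] -/
theorem AgreeUpTo.subst_congr {r : ℕ} {a a' : Fin n → MvPowerSeries (Fin n) k}
    (h : ∀ i, AgreeUpTo r (a i) (a' i)) (ha : ∀ i, MvPowerSeries.constantCoeff (a i) = 0)
    (ha' : ∀ i, MvPowerSeries.constantCoeff (a' i) = 0) (H : MvPowerSeries (Fin n) k) :
    AgreeUpTo r (MvPowerSeries.subst a H) (MvPowerSeries.subst a' H) := by
  intro e he
  rw [MvPowerSeries.coeff_subst (MvPowerSeries.hasSubst_of_constantCoeff_zero ha),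
    MvPowerSeries.coeff_subst (MvPowerSeries.hasSubst_of_constantCoeff_zero ha')]
  refine finsum_congr fun d => ?_
  congr 1
  rw [Finsupp.prod, Finsupp.prod]
  exact (AgreeUpTo.prod _ fun i _ => (h i).pow _) e he

/-- ORDER GAIN under substitution into a series WITHOUT constant and linear terms. [folklore] -/
theorem AgreeUpTo.subst_gain {r : ℕ} {a a' : Fin n → MvPowerSeries (Fin n) k}
    (h : ∀ i, AgreeUpTo r (a i) (a' i)) (ha : ∀ i, MvPowerSeries.constantCoeff (a i) = 0)
    (ha' : ∀ i, MvPowerSeries.constantCoeff (a' i) = 0) {H : MvPowerSeries (Fin n) k}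
    (hH : 2 ≤ H.order) :
    AgreeUpTo (r + 1) (MvPowerSeries.subst a H) (MvPowerSeries.subst a' H) := by
  intro e he
  rw [MvPowerSeries.coeff_subst (MvPowerSeries.hasSubst_of_constantCoeff_zero ha),
    MvPowerSeries.coeff_subst (MvPowerSeries.hasSubst_of_constantCoeff_zero ha')]
  refine finsum_congr fun d => ?_
  by_cases hd : 2 ≤ d.degree
  · congr 1
    exact (AgreeUpTo.finsuppProd_gain h ha ha' d hd) e he
  · have : MvPowerSeries.coeff d H = 0 :=
      MvPowerSeries.coeff_of_lt_order (lt_of_lt_of_le (by exact_mod_cast (by omega : d.degree < 2)) hH)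
    simp [this]

/-! ### The iteration `M₀ = X`, `M_{j+1} = X - h(M_j)` for `N = X + h` -/

section Iteration

variable (N : Fin n → MvPowerSeries (Fin n) k)

/-- The non-linear part `h = N - X`. [folklore] -/
noncomputable def nl (i : Fin n) : MvPowerSeries (Fin n) k := N i - MvPowerSeries.X i

/-- The Newton-type iteration. [folklore] -/
noncomputable def iter : ℕ → Fin n → MvPowerSeries (Fin n) k
  | 0 => MvPowerSeries.X
  | j + 1 => fun i => MvPowerSeries.X i - MvPowerSeries.subst (iter j) (nl N i)

variable {N}

/-- `two_le_order_nl` (see the module docstring). [folklore] -/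
theorem two_le_order_nl (hN : TangentId N) (i : Fin n) : 2 ≤ (nl N i).order := by
  classical
  rw [two_le_order_iff]
  refine ⟨by simp [nl, hN.1 i, MvPowerSeries.constantCoeff_X], fun j => ?_⟩
  rw [nl, map_sub, hN.2 i j, MvPowerSeries.coeff_X]
  by_cases hij : i = j
  · subst hij; simp
  · have : ¬ (Finsupp.single j 1 : Fin n →₀ ℕ) = Finsupp.single i 1 := fun hh =>
      hij ((Finsupp.single_left_inj one_ne_zero).mp hh).symm
    simp [hij, this]

/-- `constantCoeff_nl` (see the module docstring). [folklore] -/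
theorem constantCoeff_nl (hN : TangentId N) (i : Fin n) : MvPowerSeries.constantCoeff (nl N i) = 0 := by
  simp [nl, hN.1 i, MvPowerSeries.constantCoeff_X]

/-- `constantCoeff_iter` (see the module docstring). [folklore] -/
theorem constantCoeff_iter (hN : TangentId N) : ∀ (j : ℕ) (i : Fin n),
    MvPowerSeries.constantCoeff (iter N j i) = 0
  | 0, i => MvPowerSeries.constantCoeff_X i
  | j + 1, i => by
    simp only [iter, map_sub, MvPowerSeries.constantCoeff_X, zero_sub, neg_eq_zero]
    exact MvPowerSeries.constantCoeff_subst_eq_zero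
      (MvPowerSeries.hasSubst_of_constantCoeff_zero (constantCoeff_iter hN j))
      (constantCoeff_iter hN j) (constantCoeff_nl hN i)

/-- STABILITY: `M_j` and `M_{j+1}` agree up to degree `j`. [folklore] -/
theorem iter_stable (hN : TangentId N) : ∀ (j : ℕ) (i : Fin n), AgreeUpTo j (iter N j i) (iter N (j + 1) i)
  | 0, i => by
    intro e he
    have he0 : e = 0 := (Finsupp.degree_eq_zero_iff e).mp (Nat.le_zero.mp he)
    subst he0
    simp only [iter, MvPowerSeries.subst_self, id_eq, map_sub, MvPowerSeries.coeff_zero_eq_constantCoeff_apply,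
      constantCoeff_nl hN i, sub_zero]
  | j + 1, i => by
    have ih : ∀ i, AgreeUpTo j (iter N j i) (iter N (j + 1) i) := iter_stable hN j
    show AgreeUpTo (j + 1) (MvPowerSeries.X i - MvPowerSeries.subst (iter N j) (nl N i))
      (MvPowerSeries.X i - MvPowerSeries.subst (iter N (j + 1)) (nl N i))
    exact (AgreeUpTo.refl _ _).sub
      (AgreeUpTo.subst_gain ih (constantCoeff_iter hN j) (constantCoeff_iter hN (j + 1))
        (two_le_order_nl hN i))

/-- `iter_stable_le` (see the module docstring). [folklore] -/
theorem iter_stable_le (hN : TangentId N) {j j' : ℕ} (hjj : j ≤ j') (i : Fin n) :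
    AgreeUpTo j (iter N j i) (iter N j' i) := by
  induction hjj with
  | refl => exact AgreeUpTo.refl _ _
  | step hle ih => exact ih.trans ((iter_stable hN _ i).mono hle)

/-- The limit: coefficient `e` taken from `M_{deg e}`. [folklore] -/
noncomputable def invT (N : Fin n → MvPowerSeries (Fin n) k) (i : Fin n) : MvPowerSeries (Fin n) k :=
  fun e => MvPowerSeries.coeff e (iter N e.degree i)

/-- `coeff_invT` (see the module docstring). [folklore] -/
theorem coeff_invT (i : Fin n) (e : Fin n →₀ ℕ) :
    MvPowerSeries.coeff e (invT N i) = MvPowerSeries.coeff e (iter N e.degree i) := rfl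

/-- `iter_agree_invT` (see the module docstring). [folklore] -/
theorem iter_agree_invT (hN : TangentId N) (j : ℕ) (i : Fin n) : AgreeUpTo j (iter N j i) (invT N i) := by
  intro e he
  rw [coeff_invT]
  exact ((iter_stable_le hN he i) e le_rfl).symm

/-- `constantCoeff_invT` (see the module docstring). [folklore] -/
theorem constantCoeff_invT (hN : TangentId N) (i : Fin n) : MvPowerSeries.constantCoeff (invT N i) = 0 := by
  rw [← MvPowerSeries.coeff_zero_eq_constantCoeff_apply, coeff_invT,
    MvPowerSeries.coeff_zero_eq_constantCoeff_apply]
  exact constantCoeff_iter hN _ i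

/-- MAIN IDENTITY: `N ∘ invT N = id`, i.e. `subst (invT N) (N i) = X i`. [folklore] -/
theorem subst_invT (hN : TangentId N) (i : Fin n) :
    MvPowerSeries.subst (invT N) (N i) = MvPowerSeries.X i := by
  ext e
  set j := e.degree with hj
  have hinv : MvPowerSeries.HasSubst (invT N) :=
    MvPowerSeries.hasSubst_of_constantCoeff_zero (constantCoeff_invT hN)
  have hNi : N i = MvPowerSeries.X i + nl N i := by simp [nl]
  rw [hNi, MvPowerSeries.subst_add hinv, MvPowerSeries.subst_X hinv, map_add]
  -- compare with the iteration at stage j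
  have h1 : MvPowerSeries.coeff e (invT N i) = MvPowerSeries.coeff e (iter N (j + 1) i) := by
    rw [coeff_invT, ← hj]
    exact (iter_stable hN j i) e le_rfl
  have h2 : MvPowerSeries.coeff e (MvPowerSeries.subst (invT N) (nl N i)) =
      MvPowerSeries.coeff e (MvPowerSeries.subst (iter N j) (nl N i)) := by
    have := AgreeUpTo.subst_gain (fun i => (iter_agree_invT hN j i)) (constantCoeff_iter hN j)
      (constantCoeff_invT hN) (two_le_order_nl hN i)
    exact ((this e (by omega))).symm
  have h3 : MvPowerSeries.subst (iter N j) (nl N i) = MvPowerSeries.X i - iter N (j + 1) i := by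
    show _ = MvPowerSeries.X i - (MvPowerSeries.X i - MvPowerSeries.subst (iter N j) (nl N i))
    ring
  rw [h1, h2, h3, map_sub]
  ring

/-- The limit is tangent to the identity. [folklore] -/
theorem tangentId_invT (hN : TangentId N) : TangentId (invT N) := by
  classical
  refine ⟨constantCoeff_invT hN, fun i j => ?_⟩
  rw [coeff_invT, Finsupp.degree_single]
  show MvPowerSeries.coeff (Finsupp.single j 1) (MvPowerSeries.X i - MvPowerSeries.subst (iter N 0) (nl N i)) = _
  simp only [iter, MvPowerSeries.subst_self, id_eq, map_sub]
  have hnl : MvPowerSeries.coeff (Finsupp.single j 1) (nl N i) = 0 :=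
    MvPowerSeries.coeff_of_lt_order (lt_of_lt_of_le (by simp) (two_le_order_nl hN i))
  rw [hnl, sub_zero, MvPowerSeries.coeff_X]
  by_cases hij : i = j
  · subst hij; simp
  · have : ¬ (Finsupp.single j 1 : Fin n →₀ ℕ) = Finsupp.single i 1 := fun hh =>
      hij ((Finsupp.single_left_inj one_ne_zero).mp hh).symm
    simp [hij, this]

end Iteration


/-! ### Two-sided inverse in the tangent-to-identity case -/

/-- `invT N` is also a LEFT inverse: `subst N (invT N s) = X s` (uniqueness trick: a right
inverse of a right inverse is the original map). [folklore] -/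
theorem subst_invT_left {N : Fin n → MvPowerSeries (Fin n) k} (hN : TangentId N) (s : Fin n) :
    MvPowerSeries.subst N (invT N s) = MvPowerSeries.X s := by
  set I := invT N with hI
  have hIt : TangentId I := tangentId_invT hN
  set J := invT I with hJ
  have hJt : TangentId J := tangentId_invT hIt
  -- N = J
  have hNJ : ∀ s, N s = J s := by
    intro s
    calc N s = MvPowerSeries.subst MvPowerSeries.X (N s) := by rw [MvPowerSeries.subst_self]; rfl
      _ = MvPowerSeries.subst (fun m => MvPowerSeries.subst J (I m)) (N s) := by
          congr 1; funext m; exact (subst_invT hIt m).symm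
      _ = MvPowerSeries.subst J (MvPowerSeries.subst I (N s)) :=
          (MvPowerSeries.subst_comp_subst_apply hIt.hasSubst hJt.hasSubst (N s)).symm
      _ = MvPowerSeries.subst J (MvPowerSeries.X s) := by rw [subst_invT hN s]
      _ = J s := MvPowerSeries.subst_X hJt.hasSubst s
  have : N = J := funext hNJ
  rw [this]
  exact subst_invT hIt s

/-! ### General coordinate changes: the formal inverse function theorem -/

/-- `constantCoeff_linSubst` (see the module docstring). [folklore] -/
theorem constantCoeff_linSubst (M : Matrix (Fin n) (Fin n) k) (i : Fin n) :
    MvPowerSeries.constantCoeff (linSubst M i) = 0 := by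
  simp [linSubst, map_sum, MvPowerSeries.constantCoeff_X]

/-- FORMAL INVERSE FUNCTION THEOREM for `k[[x₁,…,xₙ]]`: a substitution family `θ` with zero
constant terms and invertible linear part has a two-sided compositional inverse `ψ` (zero
constant terms): `θ_s(ψ) = x_s` and `ψ_s(θ) = x_s` for all `s`. [folklore] -/
theorem exists_comp_inverse {θ : Fin n → MvPowerSeries (Fin n) k}
    (h0 : ∀ i, MvPowerSeries.constantCoeff (θ i) = 0) (hdet : IsUnit (linMat θ).det) :
    ∃ ψ : Fin n → MvPowerSeries (Fin n) k, (∀ i, MvPowerSeries.constantCoeff (ψ i) = 0) ∧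
      (∀ s, MvPowerSeries.subst ψ (θ s) = MvPowerSeries.X s) ∧
      (∀ s, MvPowerSeries.subst θ (ψ s) = MvPowerSeries.X s) := by
  set Nr := normalize θ with hNrdef
  have hNr : TangentId Nr := tangentId_normalize h0 hdet
  set I := invT Nr with hI
  have hIc : ∀ i, MvPowerSeries.constantCoeff (I i) = 0 := constantCoeff_invT hNr
  have hIs : MvPowerSeries.HasSubst I := MvPowerSeries.hasSubst_of_constantCoeff_zero hIc
  let ψ : Fin n → MvPowerSeries (Fin n) k := fun i => MvPowerSeries.subst (linSubst (linMat θ)⁻¹) (I i)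
  have hψc : ∀ i, MvPowerSeries.constantCoeff (ψ i) = 0 := fun i =>
    MvPowerSeries.constantCoeff_subst_eq_zero (hasSubst_linSubst _) (constantCoeff_linSubst _) (hIc i)
  have hψs : MvPowerSeries.HasSubst ψ := MvPowerSeries.hasSubst_of_constantCoeff_zero hψc
  refine ⟨ψ, hψc, fun s => ?_, fun s => ?_⟩
  · -- right inverse: θ(ψ) = X
    have hNrψ : ∀ j, MvPowerSeries.subst ψ (Nr j) = linSubst (linMat θ)⁻¹ j := by
      intro j
      rw [← MvPowerSeries.subst_comp_subst_apply hIs (hasSubst_linSubst (linMat θ)⁻¹) (Nr j), hI,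
        subst_invT hNr j, MvPowerSeries.subst_X (hasSubst_linSubst (linMat θ)⁻¹)]
    rw [theta_eq_linSubst_normalize hdet s, ← MvPowerSeries.coe_substAlgHom hψs, map_sum]
    simp only [map_smul, MvPowerSeries.coe_substAlgHom]
    simp_rw [← hNrdef, hNrψ]
    simp only [linSubst, Finset.smul_sum, smul_smul]
    rw [Finset.sum_comm]
    have hmul := Matrix.mul_nonsing_inv (linMat θ) hdet
    have key : ∀ y, (∑ x, linMat θ s x * (linMat θ)⁻¹ x y) = if s = y then 1 else 0 := by
      intro y
      have := congrFun (congrFun hmul s) y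
      rw [Matrix.mul_apply, Matrix.one_apply] at this
      exact this
    simp_rw [← Finset.sum_smul, key, ite_smul, one_smul, zero_smul, Finset.sum_ite_eq,
      Finset.mem_univ, if_true]
  · -- left inverse: ψ(θ) = X, via `subst θ (linSubst (linMat θ)⁻¹ m) = normalize θ m`
    have hθlin : ∀ m, MvPowerSeries.subst θ (linSubst (linMat θ)⁻¹ m) = Nr m := by
      intro m
      rw [subst_linSubst_apply (MvPowerSeries.hasSubst_of_constantCoeff_zero h0)]
      rfl
    show MvPowerSeries.subst θ (MvPowerSeries.subst (linSubst (linMat θ)⁻¹) (I s)) = _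
    rw [MvPowerSeries.subst_comp_subst_apply (hasSubst_linSubst (linMat θ)⁻¹)
      (MvPowerSeries.hasSubst_of_constantCoeff_zero h0)]
    simp_rw [hθlin]
    exact subst_invT_left hNr s


end Literature.AlgebraicGeometry.Resolution.FormalCoordChange
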